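/-
Copyright (c) 2026 the pub-hodgecm-mathlib formalisation cell (harness21).  Prover seat hodgecm-mathlib-K2E5-p16 (g6), Track B «K2-LIT»,
#184♮ = hLiu418 = `stmt-HodgeConjecture-24832`; #42S organ S2 «ARCH SPAN BY K-TYPE PATHS» (RULING «M-158f», DESIGN-S2 41bd43fff4457fcc,
BATCH #7 (b)(c)), file S2-P PART A `K2LiuU22ShilovCoordinate`: the RATIONAL Iwasawa factorisation of `U(J)` through the Shilov coordinate
`v(h) = denom(h,−i1)⁻¹·denom(h,i1) ∈ U(l)` and the coset section `v ↦ k_v = Cayley(diag(1,v)) ∈ Stab(i1)`; the compact-picture factorisation of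
every Siegel section.  THEOREMS ONLY (no `def`, no `instance`, no notation, no named-fact hypothesis, no `sorry`; generic rank `l`).
-/
import Summits.HodgeConjecture.HodgeConjecture.Theorems.K2LiuHermitianTubeFramePMinus   -- ★ K2Liu-p11: Cayley unit, `cayley_conj_mem_UJ`, `cayley_conj_blockDiag`
import Summits.HodgeConjecture.HodgeConjecture.Theorems.K2LiuArchInducedTubeDefs        -- ★ (D∞): `IsArchSiegelSection`
import HarnessLib

/-!
# Crux `HLiu418`, organ S2, S2-P part A: the Shilov coordinate and the rational Iwasawa factorisation of `U(J)`

Cell `hodgecm-mathlib`, crux item hLiu418 = `stmt-HodgeConjecture-24832` (helper lane `--supports`, count-neutral).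

Tube frame of record (★ H1-A∕B, ★ (D∞)): `U(J) = {hᴴ J h = J}`, `J = (0 −1; 1 0)`, `denom h Z = h₂₁ Z + h₂₂`, base point `i·1`, `K_w = Stab(i1)`,
Siegel parabolic `P_Δ = {h₂₁ = 0}` with law `A (p h) = χ(det p₁₁) · ‖det p₁₁‖^{2s + l} · A h` (★ `IsArchSiegelSection χ s A`).
THE POINT (DESIGN-S2 §3 «compact picture», made RATIONAL — no Iwasawa square root): with `D^± := denom h (±i·1)`,
* §1 the COSET SECTION `k_v := ½·((1+v), −i(1−v); i(1−v), (1+v)) = T₁·diag(1, v)·T₁⁻¹` (★ Cayley unit): `k_v ∈ U(J)` for unitary `v`,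
  `denom k_v (i1) = v`, `denom k_v (−i1) = 1`, `num k_v (i1) = i·v`, `k_v • i1 = i1`, `k_1 = 1`, `k_v · k_w = k_{vw}`;
* §2 for `h ∈ U(J)`: the ROW relation `D⁺ D⁺ᴴ = D⁻ D⁻ᴴ` (from `h J hᴴ = J`), `det D⁻ ≠ 0`, and the SHILOV COORDINATE `v(h) := D⁻⁻¹ D⁺` is UNITARY;
* §3 the IWASAWA FACTORISATION `h = p_h · k_{v(h)}`, `p_h := h · k_{v(h)ᴴ}`, with `(p_h)₂₁ = 0`, `(p_h)₂₂ = D⁻`, `(p_h)₁₁ = (D⁻⁻¹)ᴴ`, `p_h ∈ U(J)` — RATIONAL in `h`;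
* §4 hence for every Siegel section: **`A h = χ(det (D⁻⁻¹)ᴴ) · ‖det (D⁻⁻¹)ᴴ‖^{2s+l} · A (k_{v(h)})`** — the section is its COMPACT PICTURE `v ↦ A(k_v)` on `U(l)`
  times a multiplier of the shape of ★ `archScalarSection` read at `−i1` (`apply_eq_mul_apply_kU`).
Part B (`K2LiuU22CompactPicturePOperators`) differentiates §4 along `h_t = h₀ exp(tX)`: the right Lie derivative of a K-finite section, read in the
compact picture, is ref1's `P_β ∕ M_γ` (multiplier `p·τ + q·τ̄`, vector field `D⁻⁻¹(W⁺ − W⁻ v)`), `p = s+1+κ∕2`, `q = s+1−κ∕2`.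
References: [Shimura1997, §§5–6, §16]; [Knapp1986, Ch. VII §1 (compact picture)]; K2Liu-ref1 PREP-S2 §1 (the `U(2)` model of `I(s,χ)`).
HONEST LABEL: HC_CM is proved only modulo the 7 printed citations (2 remaining named inputs: hLiu418 = stmt-HodgeConjecture-24832,
h413 = stmt-HodgeConjecture-24833) until rung 0 closes; count-neutral helper, closes no socket.
-/

set_option autoImplicit false
set_option linter.dupNamespace false

noncomputable section

open Complex Matrix
open scoped ComplexConjugate

namespace Summit.HodgeConjecture.HodgeConjecture.Cruxes.HLiu418.K2LiuU22ShilovCoordinate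

open Literature.NumberTheory.ModularForms.SiegelUpperHalfSpace (num denom moeb num_def denom_def moeb_def num_fromBlocks denom_fromBlocks
  denom_mul num_mul)
open Summit.HodgeConjecture.HodgeConjecture.Cruxes.HLiu418.K2LiuHermitianTubeCocycle
open Summit.HodgeConjecture.HodgeConjecture.Cruxes.HLiu418.K2LiuHermitianTubeFramePMinus
open Summit.HodgeConjecture.HodgeConjecture.Cruxes.HLiu418.K2LiuArchInducedTubeDefs

variable {l : Type*} [Fintype l] [DecidableEq l]

/-! ## §1  The coset section `v ↦ k_v = Cayley(diag(1, v))` -/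

/-- `k_v` IS the Cayley conjugate of `diag(1, v)`: `T₁ · (1 0; 0 v) · (½T₁′) = ½·((1+v), −i(1−v); i(1−v), (1+v))`. [Knapp1986, Ch. VI §2] -/
theorem cayley_diag_one_eq (v : Matrix l l ℂ) :
    fromBlocks 1 1 (I • 1) (-(I • 1)) * fromBlocks 1 0 0 v * ((2 : ℂ)⁻¹ • fromBlocks 1 (-(I • 1)) 1 (I • 1)) =
      (2 : ℂ)⁻¹ • (fromBlocks (1 + v) (-(I • (1 - v))) (I • (1 - v)) (1 + v) : Matrix (l ⊕ l) (l ⊕ l) ℂ) := by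
  rw [Matrix.mul_smul, cayley_conj_blockDiag]

/-- **`k_v ∈ U(J)` for unitary `v`** (`vᴴ v = 1`). [Shimura1997, §6] -/
theorem kU_mem_UJ {v : Matrix l l ℂ} (hv : vᴴ * v = 1) :
    ((2 : ℂ)⁻¹ • (fromBlocks (1 + v) (-(I • (1 - v))) (I • (1 - v)) (1 + v) : Matrix (l ⊕ l) (l ⊕ l) ℂ))ᴴ * Matrix.J l ℂ *
        ((2 : ℂ)⁻¹ • fromBlocks (1 + v) (-(I • (1 - v))) (I • (1 - v)) (1 + v)) = Matrix.J l ℂ := by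
  rw [← cayley_diag_one_eq]
  refine cayley_conj_mem_UJ ?_
  rw [fromBlocks_conjTranspose, fromBlocks_multiply, fromBlocks_multiply]
  simp [hv]

omit [Fintype l] [DecidableEq l] in
/-- `i · (½ · (i · Y)) = −½ · Y`. [folklore] -/
theorem I_smul_half_smul_I_smul (Y : Matrix l l ℂ) : I • ((2 : ℂ)⁻¹ • (I • Y)) = -((2 : ℂ)⁻¹ • Y) := by
  rw [smul_comm I ((2 : ℂ)⁻¹) (I • Y), smul_smul, smul_smul, mul_assoc, I_mul_I, mul_neg, mul_one, neg_smul]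

/-- `denom k_v (i1) = v`. [Shimura1997, §6] -/
theorem denom_kU_I (v : Matrix l l ℂ) :
    denom ((2 : ℂ)⁻¹ • (fromBlocks (1 + v) (-(I • (1 - v))) (I • (1 - v)) (1 + v) : Matrix (l ⊕ l) (l ⊕ l) ℂ))
      (I • (1 : Matrix l l ℂ)) = v := by
  rw [fromBlocks_smul, denom_fromBlocks, (I_smul_one_mul _).2, I_smul_half_smul_I_smul]
  module

/-- `denom k_v (−i1) = 1`. [Shimura1997, §6] -/
theorem denom_kU_negI (v : Matrix l l ℂ) :
    denom ((2 : ℂ)⁻¹ • (fromBlocks (1 + v) (-(I • (1 - v))) (I • (1 - v)) (1 + v) : Matrix (l ⊕ l) (l ⊕ l) ℂ))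
      (-(I • (1 : Matrix l l ℂ))) = 1 := by
  rw [fromBlocks_smul, denom_fromBlocks, Matrix.mul_neg, (I_smul_one_mul _).2, I_smul_half_smul_I_smul]
  module

/-- `num k_v (i1) = i·v`. [Shimura1997, §6] -/
theorem num_kU_I (v : Matrix l l ℂ) :
    num ((2 : ℂ)⁻¹ • (fromBlocks (1 + v) (-(I • (1 - v))) (I • (1 - v)) (1 + v) : Matrix (l ⊕ l) (l ⊕ l) ℂ))
      (I • (1 : Matrix l l ℂ)) = I • v := by
  rw [fromBlocks_smul, num_fromBlocks, (I_smul_one_mul _).2]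
  module

/-- `num k_v (−i1) = −i·1`. [Shimura1997, §6] -/
theorem num_kU_negI (v : Matrix l l ℂ) :
    num ((2 : ℂ)⁻¹ • (fromBlocks (1 + v) (-(I • (1 - v))) (I • (1 - v)) (1 + v) : Matrix (l ⊕ l) (l ⊕ l) ℂ))
      (-(I • (1 : Matrix l l ℂ))) = -(I • (1 : Matrix l l ℂ)) := by
  rw [fromBlocks_smul, num_fromBlocks, Matrix.mul_neg, (I_smul_one_mul _).2]
  module

/-- **`k_v` fixes the base point**: `k_v • i1 = i1` (for `v` invertible). [Shimura1997, §6] -/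
theorem moeb_kU_I {v : Matrix l l ℂ} (hv : IsUnit v.det) :
    moeb ((2 : ℂ)⁻¹ • (fromBlocks (1 + v) (-(I • (1 - v))) (I • (1 - v)) (1 + v) : Matrix (l ⊕ l) (l ⊕ l) ℂ))
      (I • (1 : Matrix l l ℂ)) = I • 1 := by
  rw [moeb_def, num_kU_I, denom_kU_I, Matrix.smul_mul, Matrix.mul_nonsing_inv _ hv]

omit [Fintype l] in
/-- `k_1 = 1`. [folklore] -/
theorem kU_one : ((2 : ℂ)⁻¹ • (fromBlocks (1 + 1) (-(I • (1 - 1))) (I • (1 - 1)) (1 + 1) : Matrix (l ⊕ l) (l ⊕ l) ℂ)) = 1 := by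
  rw [sub_self, smul_zero, neg_zero, ← two_smul ℂ (1 : Matrix l l ℂ), fromBlocks_smul, smul_zero, smul_smul, inv_mul_cancel₀ two_ne_zero, one_smul,
    fromBlocks_one]

/-- **`v ↦ k_v` is multiplicative**: `k_v · k_w = k_{vw}` (conjugate of `diag(1,v)·diag(1,w) = diag(1,vw)`). [folklore] -/
theorem kU_mul (v w : Matrix l l ℂ) :
    ((2 : ℂ)⁻¹ • (fromBlocks (1 + v) (-(I • (1 - v))) (I • (1 - v)) (1 + v) : Matrix (l ⊕ l) (l ⊕ l) ℂ)) *
        ((2 : ℂ)⁻¹ • fromBlocks (1 + w) (-(I • (1 - w))) (I • (1 - w)) (1 + w)) =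
      (2 : ℂ)⁻¹ • fromBlocks (1 + v * w) (-(I • (1 - v * w))) (I • (1 - v * w)) (1 + v * w) := by
  rw [← cayley_diag_one_eq v, ← cayley_diag_one_eq w, ← cayley_diag_one_eq (v * w)]
  have hTT : ((2 : ℂ)⁻¹ • fromBlocks 1 (-(I • 1)) 1 (I • 1)) * (fromBlocks 1 1 (I • 1) (-(I • 1)) : Matrix (l ⊕ l) (l ⊕ l) ℂ) = 1 :=
    cayleyInv_mul_cayley
  have hD : (fromBlocks 1 0 0 v : Matrix (l ⊕ l) (l ⊕ l) ℂ) * fromBlocks 1 0 0 w = fromBlocks 1 0 0 (v * w) := by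
    rw [fromBlocks_multiply]
    simp
  calc fromBlocks 1 1 (I • 1) (-(I • 1)) * fromBlocks 1 0 0 v * ((2 : ℂ)⁻¹ • fromBlocks 1 (-(I • 1)) 1 (I • 1)) *
        (fromBlocks 1 1 (I • 1) (-(I • 1)) * fromBlocks 1 0 0 w * ((2 : ℂ)⁻¹ • fromBlocks 1 (-(I • 1)) 1 (I • 1)))
      = fromBlocks 1 1 (I • 1) (-(I • 1)) * (fromBlocks 1 0 0 v *
          ((((2 : ℂ)⁻¹ • fromBlocks 1 (-(I • 1)) 1 (I • 1)) * (fromBlocks 1 1 (I • 1) (-(I • 1)) : Matrix (l ⊕ l) (l ⊕ l) ℂ)) *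
            fromBlocks 1 0 0 w)) * ((2 : ℂ)⁻¹ • fromBlocks 1 (-(I • 1)) 1 (I • 1)) := by
        simp only [Matrix.mul_assoc]
    _ = fromBlocks 1 1 (I • 1) (-(I • 1)) * fromBlocks 1 0 0 (v * w) * ((2 : ℂ)⁻¹ • fromBlocks 1 (-(I • 1)) 1 (I • 1)) := by
        rw [hTT, Matrix.one_mul, hD]

/-! ## §2  The row relation and the Shilov coordinate of `h ∈ U(J)` -/

/-- `U(J)` is closed under `h ↦ hᴴ`: `h J hᴴ = J`. [Shimura1997, §5.1] -/
theorem mul_J_mul_conjTranspose {h : Matrix (l ⊕ l) (l ⊕ l) ℂ} (hh : hᴴ * Matrix.J l ℂ * h = Matrix.J l ℂ) :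
    h * Matrix.J l ℂ * hᴴ = Matrix.J l ℂ := by
  -- `(−J hᴴ J) · h = 1`, hence `h · (−J hᴴ J) = 1`, i.e. `h J hᴴ J = −1`, i.e. `h J hᴴ = J` (`J² = −1`)
  have hJJ : Matrix.J l ℂ * Matrix.J l ℂ = -1 := Matrix.J_squared l ℂ
  have h1 : (-(Matrix.J l ℂ * hᴴ * Matrix.J l ℂ)) * h = 1 := by
    have : (-(Matrix.J l ℂ * hᴴ * Matrix.J l ℂ)) * h = -(Matrix.J l ℂ * (hᴴ * Matrix.J l ℂ * h)) := by
      simp only [Matrix.neg_mul, Matrix.mul_assoc]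
    rw [this, hh, hJJ, neg_neg]
  have h2 : h * (-(Matrix.J l ℂ * hᴴ * Matrix.J l ℂ)) = 1 := mul_eq_one_comm.1 h1
  rw [Matrix.mul_neg] at h2
  have h3 : h * (Matrix.J l ℂ * hᴴ * Matrix.J l ℂ) = -1 := neg_eq_iff_eq_neg.mp h2
  calc h * Matrix.J l ℂ * hᴴ = -(h * (Matrix.J l ℂ * hᴴ * Matrix.J l ℂ) * Matrix.J l ℂ) := by
        simp only [Matrix.mul_assoc, hJJ, Matrix.mul_neg, Matrix.mul_one, neg_neg]
    _ = Matrix.J l ℂ := by rw [h3, Matrix.neg_mul, Matrix.one_mul, neg_neg]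

/-- The ROW relation of `U(J)`: `h₂₁ h₂₂ᴴ = h₂₂ h₂₁ᴴ`. [Shimura1997, §5.1] -/
theorem toBlocks₂₁_mul_conjTranspose_toBlocks₂₂ {h : Matrix (l ⊕ l) (l ⊕ l) ℂ} (hh : hᴴ * Matrix.J l ℂ * h = Matrix.J l ℂ) :
    h.toBlocks₂₁ * h.toBlocks₂₂ᴴ = h.toBlocks₂₂ * h.toBlocks₂₁ᴴ := by
  have h' := mul_J_mul_conjTranspose hh
  rw [← fromBlocks_toBlocks h, fromBlocks_conjTranspose, Matrix.J, fromBlocks_multiply, fromBlocks_multiply] at h'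
  simp only [Matrix.mul_zero, Matrix.mul_one, zero_add, add_zero, Matrix.mul_neg, Matrix.neg_mul] at h'
  obtain ⟨-, -, -, h22⟩ := fromBlocks_inj.1 h'
  -- `h22 : h₂₂ h₂₁ᴴ + −(h₂₁ h₂₂ᴴ) = 0`
  exact (add_neg_eq_zero.mp h22).symm

/-- **`D⁺ D⁺ᴴ = D⁻ D⁻ᴴ`** for `h ∈ U(J)`, `D^± = denom h (±i1)`. [Shimura1997, §6] -/
theorem denom_I_mul_conjTranspose_eq {h : Matrix (l ⊕ l) (l ⊕ l) ℂ} (hh : hᴴ * Matrix.J l ℂ * h = Matrix.J l ℂ) :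
    denom h (I • (1 : Matrix l l ℂ)) * (denom h (I • (1 : Matrix l l ℂ)))ᴴ =
      denom h (-(I • (1 : Matrix l l ℂ))) * (denom h (-(I • (1 : Matrix l l ℂ))))ᴴ := by
  have hrow := toBlocks₂₁_mul_conjTranspose_toBlocks₂₂ hh
  rw [denom_def, denom_def, Matrix.mul_neg, Matrix.mul_smul, Matrix.mul_one, conjTranspose_add, conjTranspose_add, conjTranspose_neg,
    conjTranspose_smul, Complex.star_def, conj_I, neg_smul, neg_neg]
  rw [Matrix.add_mul, Matrix.mul_add, Matrix.mul_add, Matrix.add_mul, Matrix.mul_add, Matrix.mul_add]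
  simp only [Matrix.smul_mul, Matrix.mul_smul, smul_smul, neg_mul, mul_neg, I_mul_I, hrow]
  abel

/-- `det D⁻ ≠ 0` for `h ∈ U(J)` (from `D⁻D⁻ᴴ = D⁺D⁺ᴴ` and ★ `isUnit_det_denom` at `i1`). [Shimura1997, §6] -/
theorem isUnit_det_denom_negI {h : Matrix (l ⊕ l) (l ⊕ l) ℂ} (hh : hᴴ * Matrix.J l ℂ * h = Matrix.J l ℂ) :
    IsUnit (denom h (-(I • (1 : Matrix l l ℂ)))).det := by
  have hD : IsUnit (denom h (I • (1 : Matrix l l ℂ))).det := isUnit_det_denom hh posDef_im_I_smul_one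
  have h := congrArg Matrix.det (denom_I_mul_conjTranspose_eq hh)
  rw [det_mul, det_mul, det_conjTranspose, det_conjTranspose] at h
  refine isUnit_iff_ne_zero.2 fun h0 => ?_
  rw [h0, zero_mul] at h
  exact (mul_ne_zero hD.ne_zero (by rw [Complex.star_def]; exact (map_ne_zero _).2 hD.ne_zero)) h

/-- **THE SHILOV COORDINATE IS UNITARY**: `v(h) := D⁻⁻¹ D⁺` satisfies `v vᴴ = 1` and `vᴴ v = 1` for `h ∈ U(J)`. [Shimura1997, §6; Knapp1986, VII §1] -/
theorem shilov_mul_conjTranspose {h : Matrix (l ⊕ l) (l ⊕ l) ℂ} (hh : hᴴ * Matrix.J l ℂ * h = Matrix.J l ℂ) :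
    ((denom h (-(I • (1 : Matrix l l ℂ))))⁻¹ * denom h (I • (1 : Matrix l l ℂ))) *
        ((denom h (-(I • (1 : Matrix l l ℂ))))⁻¹ * denom h (I • (1 : Matrix l l ℂ)))ᴴ = 1 := by
  have hu := isUnit_det_denom_negI hh
  have huH : IsUnit (denom h (-(I • (1 : Matrix l l ℂ))))ᴴ.det := by rw [det_conjTranspose]; exact hu.star
  rw [conjTranspose_mul, conjTranspose_nonsing_inv, Matrix.mul_assoc, ← Matrix.mul_assoc (denom h (I • 1)), denom_I_mul_conjTranspose_eq hh,
    Matrix.mul_assoc, Matrix.mul_nonsing_inv _ huH, Matrix.mul_one, Matrix.nonsing_inv_mul _ hu]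

/-- The Shilov coordinate, `vᴴ v = 1` form. [Shimura1997, §6] -/
theorem conjTranspose_shilov_mul {h : Matrix (l ⊕ l) (l ⊕ l) ℂ} (hh : hᴴ * Matrix.J l ℂ * h = Matrix.J l ℂ) :
    ((denom h (-(I • (1 : Matrix l l ℂ))))⁻¹ * denom h (I • (1 : Matrix l l ℂ)))ᴴ *
        ((denom h (-(I • (1 : Matrix l l ℂ))))⁻¹ * denom h (I • (1 : Matrix l l ℂ))) = 1 :=
  mul_eq_one_comm.1 (shilov_mul_conjTranspose hh)

/-! ## §3  The rational Iwasawa factorisation `h = p_h · k_{v(h)}` -/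

/-- Bookkeeping: `D⁺ = h₂₂ + i·h₂₁`, `D⁻ = h₂₂ − i·h₂₁`. [folklore] -/
theorem denom_I_eq_blocks (h : Matrix (l ⊕ l) (l ⊕ l) ℂ) :
    denom h (I • (1 : Matrix l l ℂ)) = h.toBlocks₂₂ + I • h.toBlocks₂₁ ∧
      denom h (-(I • (1 : Matrix l l ℂ))) = h.toBlocks₂₂ - I • h.toBlocks₂₁ := by
  rw [denom_def, denom_def, Matrix.mul_neg, Matrix.mul_smul, Matrix.mul_one]
  exact ⟨by abel, by abel⟩

/-- The two block identities behind the factorisation: for any `w`,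
`h₂₁ (1 + w) + h₂₂ · i(1 − w) = i·(D⁻ − D⁺ w)` and `h₂₁ · (−i(1 − w)) + h₂₂ (1 + w) = D⁻ + D⁺ w`. [folklore] -/
theorem blocks_key (h : Matrix (l ⊕ l) (l ⊕ l) ℂ) (w : Matrix l l ℂ) :
    h.toBlocks₂₁ * (1 + w) + h.toBlocks₂₂ * (I • (1 - w)) =
        I • (denom h (-(I • (1 : Matrix l l ℂ))) - denom h (I • (1 : Matrix l l ℂ)) * w) ∧
      h.toBlocks₂₁ * (-(I • (1 - w))) + h.toBlocks₂₂ * (1 + w) =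
        denom h (-(I • (1 : Matrix l l ℂ))) + denom h (I • (1 : Matrix l l ℂ)) * w := by
  obtain ⟨hp, hm⟩ := denom_I_eq_blocks h
  rw [hp, hm]
  constructor
  · simp only [Matrix.mul_add, Matrix.mul_one, Matrix.mul_smul, Matrix.mul_sub, Matrix.add_mul, Matrix.smul_mul, smul_sub, smul_add, smul_smul,
      I_mul_I, neg_one_smul]
    module
  · simp only [Matrix.mul_neg, Matrix.mul_smul, Matrix.mul_sub, Matrix.mul_one, Matrix.mul_add, Matrix.add_mul, Matrix.smul_mul, smul_sub]
    module

/-- `D⁺ · v(h)ᴴ = D⁻` for `h ∈ U(J)` (`v(h) = D⁻⁻¹D⁺`). [Shimura1997, §6] -/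
theorem denom_I_mul_shilov_conjTranspose {h : Matrix (l ⊕ l) (l ⊕ l) ℂ} (hh : hᴴ * Matrix.J l ℂ * h = Matrix.J l ℂ) :
    denom h (I • (1 : Matrix l l ℂ)) * ((denom h (-(I • (1 : Matrix l l ℂ))))⁻¹ * denom h (I • (1 : Matrix l l ℂ)))ᴴ =
      denom h (-(I • (1 : Matrix l l ℂ))) := by
  have hu := isUnit_det_denom_negI hh
  have huH : IsUnit (denom h (-(I • (1 : Matrix l l ℂ))))ᴴ.det := by rw [det_conjTranspose]; exact hu.star
  rw [conjTranspose_mul, conjTranspose_nonsing_inv, ← Matrix.mul_assoc, denom_I_mul_conjTranspose_eq hh, Matrix.mul_assoc,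
    Matrix.mul_nonsing_inv _ huH, Matrix.mul_one]

/-- **THE IWASAWA FACTOR `p_h := h · k_{v(h)ᴴ}` IS SIEGEL-PARABOLIC with `(p_h)₂₂ = D⁻`** (`h ∈ U(J)`):
its lower blocks are `(0, D⁻)`. [Knapp1986, VII §1; Shimura1997, §6] -/
theorem iwasawa_lower_blocks {h : Matrix (l ⊕ l) (l ⊕ l) ℂ} (hh : hᴴ * Matrix.J l ℂ * h = Matrix.J l ℂ) :
    (h * ((2 : ℂ)⁻¹ • fromBlocks (1 + ((denom h (-(I • (1 : Matrix l l ℂ))))⁻¹ * denom h (I • (1 : Matrix l l ℂ)))ᴴ)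
        (-(I • (1 - ((denom h (-(I • (1 : Matrix l l ℂ))))⁻¹ * denom h (I • (1 : Matrix l l ℂ)))ᴴ)))
        (I • (1 - ((denom h (-(I • (1 : Matrix l l ℂ))))⁻¹ * denom h (I • (1 : Matrix l l ℂ)))ᴴ))
        (1 + ((denom h (-(I • (1 : Matrix l l ℂ))))⁻¹ * denom h (I • (1 : Matrix l l ℂ)))ᴴ))).toBlocks₂₁ = 0 ∧
    (h * ((2 : ℂ)⁻¹ • fromBlocks (1 + ((denom h (-(I • (1 : Matrix l l ℂ))))⁻¹ * denom h (I • (1 : Matrix l l ℂ)))ᴴ)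
        (-(I • (1 - ((denom h (-(I • (1 : Matrix l l ℂ))))⁻¹ * denom h (I • (1 : Matrix l l ℂ)))ᴴ)))
        (I • (1 - ((denom h (-(I • (1 : Matrix l l ℂ))))⁻¹ * denom h (I • (1 : Matrix l l ℂ)))ᴴ))
        (1 + ((denom h (-(I • (1 : Matrix l l ℂ))))⁻¹ * denom h (I • (1 : Matrix l l ℂ)))ᴴ))).toBlocks₂₂ =
      denom h (-(I • (1 : Matrix l l ℂ))) := by
  set w : Matrix l l ℂ := ((denom h (-(I • (1 : Matrix l l ℂ))))⁻¹ * denom h (I • (1 : Matrix l l ℂ)))ᴴ with hw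
  have hDpw : denom h (I • (1 : Matrix l l ℂ)) * w = denom h (-(I • (1 : Matrix l l ℂ))) := denom_I_mul_shilov_conjTranspose hh
  obtain ⟨k21, k22⟩ := blocks_key h w
  have hprod : h * ((2 : ℂ)⁻¹ • fromBlocks (1 + w) (-(I • (1 - w))) (I • (1 - w)) (1 + w)) =
      (2 : ℂ)⁻¹ • fromBlocks (h.toBlocks₁₁ * (1 + w) + h.toBlocks₁₂ * (I • (1 - w))) (h.toBlocks₁₁ * (-(I • (1 - w))) + h.toBlocks₁₂ * (1 + w))
        (h.toBlocks₂₁ * (1 + w) + h.toBlocks₂₂ * (I • (1 - w))) (h.toBlocks₂₁ * (-(I • (1 - w))) + h.toBlocks₂₂ * (1 + w)) := by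
    conv_lhs => rw [← fromBlocks_toBlocks h]
    rw [Matrix.mul_smul, fromBlocks_multiply]
  rw [hprod, fromBlocks_smul, toBlocks_fromBlocks₂₁, toBlocks_fromBlocks₂₂, k21, k22, hDpw, sub_self, smul_zero, smul_zero,
    ← two_smul ℂ, smul_smul, inv_mul_cancel₀ two_ne_zero, one_smul]
  exact ⟨rfl, rfl⟩

/-- **`p_h ∈ U(J)`** (product of elements of `U(J)`; `v(h)ᴴ` is unitary). [Shimura1997, §5.1] -/
theorem iwasawa_mem_UJ {h : Matrix (l ⊕ l) (l ⊕ l) ℂ} (hh : hᴴ * Matrix.J l ℂ * h = Matrix.J l ℂ) :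
    (h * ((2 : ℂ)⁻¹ • fromBlocks (1 + ((denom h (-(I • (1 : Matrix l l ℂ))))⁻¹ * denom h (I • (1 : Matrix l l ℂ)))ᴴ)
        (-(I • (1 - ((denom h (-(I • (1 : Matrix l l ℂ))))⁻¹ * denom h (I • (1 : Matrix l l ℂ)))ᴴ)))
        (I • (1 - ((denom h (-(I • (1 : Matrix l l ℂ))))⁻¹ * denom h (I • (1 : Matrix l l ℂ)))ᴴ))
        (1 + ((denom h (-(I • (1 : Matrix l l ℂ))))⁻¹ * denom h (I • (1 : Matrix l l ℂ)))ᴴ)))ᴴ * Matrix.J l ℂ *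
      (h * ((2 : ℂ)⁻¹ • fromBlocks (1 + ((denom h (-(I • (1 : Matrix l l ℂ))))⁻¹ * denom h (I • (1 : Matrix l l ℂ)))ᴴ)
        (-(I • (1 - ((denom h (-(I • (1 : Matrix l l ℂ))))⁻¹ * denom h (I • (1 : Matrix l l ℂ)))ᴴ)))
        (I • (1 - ((denom h (-(I • (1 : Matrix l l ℂ))))⁻¹ * denom h (I • (1 : Matrix l l ℂ)))ᴴ))
        (1 + ((denom h (-(I • (1 : Matrix l l ℂ))))⁻¹ * denom h (I • (1 : Matrix l l ℂ)))ᴴ))) = Matrix.J l ℂ := by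
  refine mul_mem_UJ hh (kU_mem_UJ ?_)
  rw [conjTranspose_conjTranspose]
  exact shilov_mul_conjTranspose hh

/-- **`h = p_h · k_{v(h)}`** (`k_{vᴴ} · k_v = k_{vᴴ v} = k_1 = 1` for the unitary Shilov coordinate). [Knapp1986, VII §1] -/
theorem iwasawa_mul_kU {h : Matrix (l ⊕ l) (l ⊕ l) ℂ} (hh : hᴴ * Matrix.J l ℂ * h = Matrix.J l ℂ) :
    h * ((2 : ℂ)⁻¹ • fromBlocks (1 + ((denom h (-(I • (1 : Matrix l l ℂ))))⁻¹ * denom h (I • (1 : Matrix l l ℂ)))ᴴ)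
        (-(I • (1 - ((denom h (-(I • (1 : Matrix l l ℂ))))⁻¹ * denom h (I • (1 : Matrix l l ℂ)))ᴴ)))
        (I • (1 - ((denom h (-(I • (1 : Matrix l l ℂ))))⁻¹ * denom h (I • (1 : Matrix l l ℂ)))ᴴ))
        (1 + ((denom h (-(I • (1 : Matrix l l ℂ))))⁻¹ * denom h (I • (1 : Matrix l l ℂ)))ᴴ)) *
      ((2 : ℂ)⁻¹ • fromBlocks (1 + (denom h (-(I • (1 : Matrix l l ℂ))))⁻¹ * denom h (I • (1 : Matrix l l ℂ)))
        (-(I • (1 - (denom h (-(I • (1 : Matrix l l ℂ))))⁻¹ * denom h (I • (1 : Matrix l l ℂ)))))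
        (I • (1 - (denom h (-(I • (1 : Matrix l l ℂ))))⁻¹ * denom h (I • (1 : Matrix l l ℂ))))
        (1 + (denom h (-(I • (1 : Matrix l l ℂ))))⁻¹ * denom h (I • (1 : Matrix l l ℂ)))) = h := by
  rw [Matrix.mul_assoc, kU_mul, conjTranspose_shilov_mul hh, kU_one, Matrix.mul_one]

/-- **THE LEVI BLOCK OF `p_h`**: `(p_h)₁₁ = (D⁻⁻¹)ᴴ` — from the `U(J)` relation `p₁₁ᴴ p₂₂ − p₂₁ᴴ p₁₂ = 1` with `p₂₁ = 0`, `p₂₂ = D⁻`.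
[Shimura1997, §5.1] -/
theorem iwasawa_toBlocks₁₁ {h : Matrix (l ⊕ l) (l ⊕ l) ℂ} (hh : hᴴ * Matrix.J l ℂ * h = Matrix.J l ℂ) :
    (h * ((2 : ℂ)⁻¹ • fromBlocks (1 + ((denom h (-(I • (1 : Matrix l l ℂ))))⁻¹ * denom h (I • (1 : Matrix l l ℂ)))ᴴ)
        (-(I • (1 - ((denom h (-(I • (1 : Matrix l l ℂ))))⁻¹ * denom h (I • (1 : Matrix l l ℂ)))ᴴ)))
        (I • (1 - ((denom h (-(I • (1 : Matrix l l ℂ))))⁻¹ * denom h (I • (1 : Matrix l l ℂ)))ᴴ))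
        (1 + ((denom h (-(I • (1 : Matrix l l ℂ))))⁻¹ * denom h (I • (1 : Matrix l l ℂ)))ᴴ))).toBlocks₁₁ =
      ((denom h (-(I • (1 : Matrix l l ℂ))))⁻¹)ᴴ := by
  obtain ⟨h21, h22⟩ := iwasawa_lower_blocks hh
  obtain ⟨-, -, h3, -⟩ := blocks_rel (iwasawa_mem_UJ hh)
  rw [h21, h22, conjTranspose_zero, Matrix.zero_mul, sub_zero] at h3
  -- `h3 : p₁₁ᴴ · D⁻ = 1`, so `D⁻⁻¹ = p₁₁ᴴ`
  have h4 := Matrix.inv_eq_left_inv h3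
  exact ((congrArg conjTranspose h4).trans (conjTranspose_conjTranspose _)).symm

/-! ## §4  Every Siegel section factors through its compact picture -/

/-- **THE COMPACT-PICTURE FACTORISATION OF A SIEGEL SECTION**: for `A ∈ I_w(s, χ)` (★ `IsArchSiegelSection χ s A`) and `h ∈ U(J)`,
`A h = χ(det (D⁻⁻¹)ᴴ) · ‖det (D⁻⁻¹)ᴴ‖^{2s + l} · A(k_{v(h)})`, `D⁻ = denom h (−i1)`, `v(h) = D⁻⁻¹ · denom h (i1)` — the section is its compact
picture `v ↦ A(k_v)` on `U(l)` times an explicit rational multiplier. [Knapp1986, VII §1; Shimura1997, §16] -/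
theorem apply_eq_mul_apply_kU {χ : ℂ → ℂ} {s : ℂ} {A : Matrix (l ⊕ l) (l ⊕ l) ℂ → ℂ} (hA : IsArchSiegelSection χ s A)
    {h : Matrix (l ⊕ l) (l ⊕ l) ℂ} (hh : hᴴ * Matrix.J l ℂ * h = Matrix.J l ℂ) :
    A h = χ ((denom h (-(I • (1 : Matrix l l ℂ))))⁻¹)ᴴ.det *
      ((((‖((denom h (-(I • (1 : Matrix l l ℂ))))⁻¹)ᴴ.det‖ : ℝ) : ℂ)) ^ (2 * s + (Fintype.card l : ℂ))) *
        A ((2 : ℂ)⁻¹ • fromBlocks (1 + (denom h (-(I • (1 : Matrix l l ℂ))))⁻¹ * denom h (I • (1 : Matrix l l ℂ)))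
          (-(I • (1 - (denom h (-(I • (1 : Matrix l l ℂ))))⁻¹ * denom h (I • (1 : Matrix l l ℂ)))))
          (I • (1 - (denom h (-(I • (1 : Matrix l l ℂ))))⁻¹ * denom h (I • (1 : Matrix l l ℂ))))
          (1 + (denom h (-(I • (1 : Matrix l l ℂ))))⁻¹ * denom h (I • (1 : Matrix l l ℂ)))) := by
  have hfac := iwasawa_mul_kU hh
  have hP := iwasawa_mem_UJ hh
  obtain ⟨h21, -⟩ := iwasawa_lower_blocks hh
  have h11 := iwasawa_toBlocks₁₁ hh
  conv_lhs => rw [← hfac]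
  rw [hA _ _ hP h21, h11]

end Summit.HodgeConjecture.HodgeConjecture.Cruxes.HLiu418.K2LiuU22ShilovCoordinate

end
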